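import Literature.NumberTheory.DiophantineGeometry.MordellAlmostPrimitiveReductionProofs
import Literature.NumberTheory.DiophantineGeometry.OptimizedSimplifiedHeightBoundsProofs
import Mathlib.Analysis.Complex.ExponentialBounds
import HarnessLib

/-!
# von Känel–Matschke, Theorem 7.2 (i) (almost primitive solutions of Mordell equations) from the §10 roots —
# the printed proof of §10.3 in kernel

Topic `Literature/NumberTheory/DiophantineGeometry` (family `abc`). Theorems only — NO definition, NO new named
fact (D-0014, D-0026). R. von Känel, B. Matschke, arXiv:1605.06079 = Mem. AMS 286 (2023) no. 1419
[`VonkanelMatschke2023`], §10.3 "Proof of Theorem (thm:m)" (held TeX text, p. 58–59 of the chunked text):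

*First part of (i).* For a solution `(x, y)` which is almost primitive w.r.t. `μ`, with `u = u_{x,y}`,
`(x', y') = (u²x, u³y) ∈ ℤ × ℤ` is a primitive solution of `y'² = x'³ + a'`, `a' = u⁶a ∈ ℤ`
(`exists_primitive_reduction`); Lemmas 10.3/10.4 give `E` with `Δ_E = 2^m 3^n |a'|` (`m ∈ {−6,6}`,
`n ∈ {−3,9}`) and `N_E ∣ a'_S ∣ a_S`; `h(a) ≤ 6h(u) + log|a'|`, `h(u) ≤ μ(a_S)`; with (eq:szpiro) for `log Δ_E`
(`ν(N_E) ≤ ν(a_S) ≤ (2/3)a_S` by (eq:nuineq)) this bounds `h(a)`, and Prop. 10.1 (`Ω_sim`) gives the first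
display `(2/3)a_S log a_S + (1/4)a_S log₃a_S + (3/5)a_S + 2μ(a_S)` for EVERY solution.
*Second part of (i).* If `(x, y)` is itself almost primitive: `h(x) ≤ 2μ + h(x')`, `(2/3)h(y) ≤ 2μ + (2/3)h(y')`,
Lemma 10.4 (iii) `max(h(x'), (2/3)h(y')) ≤ 4h(E) + 2 log max(1, h(E)) + 28` and Prop. 10.8 for `h(E)` give
the second display `(2/9)a_S log a_S + (1/12)a_S log₃a_S + (1/4)a_S + 2μ(a_S)`.

## What is proved here

* `nu_terms_le` — the bookkeeping "`ν(N_E) ≤ (2/3)a_S`" with its logarithmic companions (`N_E ∣ a_S`,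
  `36 ∣ a_S`, `a_S ≥ 1728`; `condNu_mono_of_dvd`, `condNu_le_two_thirds`).
* `theorem_7_2_i_of_roots` — **`theorem_7_2_i` ⇐ {modularity (`nonempty_modularParametrizationData`),
  Lemma 10.3, Lemma 10.4, Prop. 10.8 (i)}** (Prop. 10.8 (ii) and `Ω_opt ≤ Ω_sim` being theorems of the tree;
  Prop. 10.1 enters through `mordell_height_le_of_lemma_10_3_of_prop_10_8_i`, (eq:szpiro) through
  `log_minimalDiscriminant_le_of_prop_10_8_i`). With `theoremG_of_theorem_7_2_i` /
  `corollaryH_of_theorem_7_2_i` (`MordellPrimitiveSolutionsHeightBoundsProofs`), Theorem G and Corollary H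
  hang off the same roots.

Kernel constants: `log 1728 ≤ 7.63`, `κ ≤ 16.52`, `(log 1728 + 115.1)/3 ≤ 40.9 ≤ (3/5 − 4/27 − 2/5)·1728`,
`2 log max(1, h(E)) ≤ 4 log a_S ≤ 26.5 + a_S/432`. No `abc` claim; axioms standard.
-/

noncomputable section

open Height WeierstrassCurve
open Literature.NumberTheory.EllipticCurves.ModularForms

namespace Literature.NumberTheory.DiophantineGeometry

namespace VonKanelMatschke

/-! ### Real-analysis helpers (junk-valued triple logarithm) -/

/-- `log log log x ≥ 0` for `x ≥ 16`. [folklore] -/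
private theorem l3_nonneg_16 {x : ℝ} (hx : 16 ≤ x) : 0 ≤ Real.log (Real.log (Real.log x)) := by
  have hl2 := Real.log_two_gt_d9
  have he := Real.exp_one_lt_d9
  have h16 : Real.log 16 = 4 * Real.log 2 := by
    rw [show (16 : ℝ) = 2 ^ 4 by norm_num, Real.log_pow]; push_cast; ring
  have h1 : Real.exp 1 ≤ Real.log x := by
    have := Real.log_le_log (by norm_num) hx
    linarith
  have h2 : 1 ≤ Real.log (Real.log x) := by
    have := Real.log_le_log (Real.exp_pos 1) h1
    rwa [Real.log_exp] at this
  exact Real.log_nonneg h2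

/-- Monotonicity of the triple logarithm where it is positive. [folklore] -/
private theorem l3_mono {y z : ℝ} (hy : 2 ≤ y) (hyz : y ≤ z)
    (hpos : 0 < Real.log (Real.log (Real.log y))) :
    Real.log (Real.log (Real.log y)) ≤ Real.log (Real.log (Real.log z)) := by
  have hl2 := Real.log_two_gt_d9
  have hL1 : Real.log 2 ≤ Real.log y := Real.log_le_log (by norm_num) hy
  have hL1pos : 0 < Real.log y := by linarith
  have hL2pos : 0 < Real.log (Real.log y) := by
    by_contra h
    push Not at h
    rcases eq_or_lt_of_le h with h0 | hlt
    · rw [h0, Real.log_zero] at hpos; exact lt_irrefl _ hpos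
    · have hm1 : -1 ≤ Real.log (Real.log y) := by
        have he := Real.exp_one_gt_d9
        have h1 : Real.exp (-1) ≤ Real.log 2 := by
          rw [Real.exp_neg]
          have : (Real.exp 1)⁻¹ ≤ (2.7182818283 : ℝ)⁻¹ := inv_anti₀ (by norm_num) he.le
          have h2 : (2.7182818283 : ℝ)⁻¹ ≤ 0.6931471803 := by norm_num
          linarith
        have h2 := Real.log_le_log (Real.exp_pos _) (h1.trans hL1)
        rwa [Real.log_exp] at h2
      have : Real.log (Real.log (Real.log y)) ≤ 0 := by
        rw [← Real.log_neg_eq_log]; exact Real.log_nonpos (by linarith) (by linarith)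
      linarith
  exact Real.log_le_log hL2pos (Real.log_le_log hL1pos (Real.log_le_log (by linarith) hyz))

/-- `log 1728 ≤ 7.63` (`1728 ≤ 2048 = 2¹¹`). [folklore] -/
private theorem log_1728_le : Real.log 1728 ≤ 7.63 := by
  have hl2 := Real.log_two_lt_d9
  have h1 : Real.log (1728 : ℝ) ≤ Real.log 2048 := Real.log_le_log (by norm_num) (by norm_num)
  rw [show (2048 : ℝ) = 2 ^ 11 by norm_num, Real.log_pow] at h1
  push_cast at h1; linarith

/-! ### "`ν(N_E) ≤ (2/3) a_S`" and its companions -/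

/-- **The bookkeeping of §10.3** ("It follows from (eq:nuineq) that `ν(N_E) ≤ (2/3)a_S`"): for `11 ≤ N ∣ M`
with `1728 ≤ M`, `4 ∣ M`, `9 ∣ M`: `ν(N) ≤ (2/3)M`, `ν(N) log N ≤ (2/3)M log M`,
`ν(N) log₃N ≤ (2/3)M log₃M`, `0 ≤ log₃ M`, `log M ≤ 11 log 2 + M/1728 − 1`, `N ≤ M`.
[cite: VonkanelMatschke2023, §10.3 (proof of Prop. 10.1: ν(N_E) ≤ (2/3)a_S via (eq:nuineq))] -/
theorem nu_terms_le {N M : ℕ} (hN11 : 11 ≤ N) (hNM : N ∣ M) (hM : 1728 ≤ M) (h4 : 4 ∣ M) (h9 : 9 ∣ M) :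
    condNu N ≤ 2 / 3 * (M : ℝ) ∧
    condNu N * Real.log N ≤ 2 / 3 * (M : ℝ) * Real.log M ∧
    condNu N * Real.log (Real.log (Real.log N)) ≤ 2 / 3 * (M : ℝ) * Real.log (Real.log (Real.log M)) ∧
    0 ≤ Real.log (Real.log (Real.log (M : ℝ))) ∧
    Real.log (M : ℝ) ≤ 11 * Real.log 2 + ((M : ℝ) / 1728 - 1) ∧ (N : ℝ) ≤ M := by
  have hM0 : M ≠ 0 := by omega
  have hM' : (1728 : ℝ) ≤ M := by exact_mod_cast hM
  have hN' : (11 : ℝ) ≤ N := by exact_mod_cast hN11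
  have hNM' : (N : ℝ) ≤ M := by exact_mod_cast Nat.le_of_dvd (Nat.pos_of_ne_zero hM0) hNM
  have hν : condNu N ≤ 2 / 3 * (M : ℝ) :=
    (condNu_mono_of_dvd hM0 hNM).trans (condNu_le_two_thirds hM0 h4 h9)
  have hν0 : 0 ≤ condNu N := condNu_nonneg N
  have hlogN0 : 0 ≤ Real.log (N : ℝ) := Real.log_nonneg (by linarith)
  have hlogNM : Real.log (N : ℝ) ≤ Real.log M := Real.log_le_log (by linarith) hNM'
  have hlogM0 : 0 ≤ Real.log (M : ℝ) := by linarith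
  have hl3M : 0 ≤ Real.log (Real.log (Real.log (M : ℝ))) := l3_nonneg_16 (by linarith)
  refine ⟨hν, (mul_le_mul_of_nonneg_left hlogNM hν0).trans (mul_le_mul_of_nonneg_right hν hlogM0), ?_,
    hl3M, ?_, hNM'⟩
  · by_cases hn : 0 < Real.log (Real.log (Real.log (N : ℝ)))
    · exact (mul_le_mul_of_nonneg_left (l3_mono (by linarith) hNM' hn) hν0).trans
        (mul_le_mul_of_nonneg_right hν hl3M)
    · push Not at hn
      have h3 : condNu N * Real.log (Real.log (Real.log (N : ℝ))) ≤ 0 :=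
        mul_nonpos_of_nonneg_of_nonpos hν0 hn
      have h4' : 0 ≤ 2 / 3 * (M : ℝ) * Real.log (Real.log (Real.log (M : ℝ))) := by positivity
      linarith
  · have e1 : Real.log (M : ℝ) = Real.log 1728 + Real.log ((M : ℝ) / 1728) := by
      rw [← Real.log_mul (by norm_num) (by positivity)]; congr 1; field_simp
    have e2 : Real.log ((M : ℝ) / 1728) ≤ (M : ℝ) / 1728 - 1 := Real.log_le_sub_one_of_pos (by positivity)
    have e3 : Real.log (1728 : ℝ) ≤ Real.log 2048 := Real.log_le_log (by norm_num) (by norm_num)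
    have e4 : Real.log (2048 : ℝ) = 11 * Real.log 2 := by
      rw [show (2048 : ℝ) = 2 ^ 11 by norm_num, Real.log_pow]; push_cast; ring
    linarith

/-- `36 ∣ a_S`, `a_S ≥ 1728` (from the definition `a_S = 1728 N_S² r₂(a)`). [cite: VonkanelMatschke2023, §10.3 (a_S = 1728 N_S² r₂(a))] -/
theorem mordellLevel_dvd_facts {S : Finset ℕ} (hS : ∀ p ∈ S, p.Prime) (a : ℚ) :
    1728 ≤ mordellLevel S a ∧ 4 ∣ mordellLevel S a ∧ 9 ∣ mordellLevel S a := by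
  refine ⟨le_mordellLevel hS a, ?_, ?_⟩
  · rw [mordellLevel_def]; exact Dvd.dvd.mul_right (Dvd.dvd.mul_right (by norm_num) _) _
  · rw [mordellLevel_def]; exact Dvd.dvd.mul_right (Dvd.dvd.mul_right (by norm_num) _) _

/-- `log|a'| ≤ log 1728 + log Δ_E` from `Δ_E = 2^m 3^n |a'|`, `m ∈ {−6, 6}`, `n ∈ {−3, 9}` (Lemma 10.4 (i)).
[cite: VonkanelMatschke2023, Lemma 10.4 (i) and §10.3 (proof of Thm. 7.2: (eq:deltaea))] -/
theorem log_abs_le_of_delta_eq {a' : ℤ} (ha' : a' ≠ 0) {Δ : ℕ} {m n : ℤ} (hm : m ∈ ({-6, 6} : Finset ℤ))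
    (hn : n ∈ ({-3, 9} : Finset ℤ)) (hΔ : (Δ : ℚ) = (2 : ℚ) ^ m * (3 : ℚ) ^ n * |(a' : ℚ)|) :
    Real.log |(a' : ℝ)| ≤ Real.log 1728 + Real.log (Δ : ℝ) := by
  have hΔ' : (Δ : ℝ) = (2 : ℝ) ^ m * (3 : ℝ) ^ n * |(a' : ℝ)| := by
    have := congrArg (Rat.cast : ℚ → ℝ) hΔ
    push_cast at this
    exact this
  have ha0 : 0 < |(a' : ℝ)| := abs_pos.mpr (by exact_mod_cast ha')
  have hm6 : (2 : ℝ) ^ (-6 : ℤ) ≤ (2 : ℝ) ^ m := by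
    refine zpow_le_zpow_right₀ (by norm_num) ?_
    simp only [Finset.mem_insert, Finset.mem_singleton] at hm; omega
  have hn3 : (3 : ℝ) ^ (-3 : ℤ) ≤ (3 : ℝ) ^ n := by
    refine zpow_le_zpow_right₀ (by norm_num) ?_
    simp only [Finset.mem_insert, Finset.mem_singleton] at hn; omega
  have h26 : (2 : ℝ) ^ (-6 : ℤ) = 1 / 64 := by norm_num
  have h33 : (3 : ℝ) ^ (-3 : ℤ) = 1 / 27 := by norm_num
  have hprod : 1 / 1728 ≤ (2 : ℝ) ^ m * (3 : ℝ) ^ n := by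
    have h2 : 0 ≤ (2 : ℝ) ^ m := zpow_nonneg (by norm_num) _
    calc (1 : ℝ) / 1728 = (2 : ℝ) ^ (-6 : ℤ) * (3 : ℝ) ^ (-3 : ℤ) := by rw [h26, h33]; norm_num
      _ ≤ (2 : ℝ) ^ m * (3 : ℝ) ^ n := mul_le_mul hm6 hn3 (by positivity) h2
  have h1 : |(a' : ℝ)| ≤ 1728 * (Δ : ℝ) := by
    rw [hΔ']
    nlinarith [mul_le_mul_of_nonneg_right hprod ha0.le]
  have hΔ0 : 0 < (Δ : ℝ) := by
    by_contra h
    push Not at h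
    have : |(a' : ℝ)| ≤ 0 := h1.trans (by linarith)
    linarith
  calc Real.log |(a' : ℝ)| ≤ Real.log (1728 * (Δ : ℝ)) := Real.log_le_log ha0 h1
    _ = Real.log 1728 + Real.log (Δ : ℝ) := Real.log_mul (by norm_num) hΔ0.ne'

/-- `2 log max(1, h(E)) ≤ 4 log a_S` whenever `2h(E) ≤ κ + (1/9)a_S log a_S + (1/24)a_S log₃a_S + (2/27)a_S`
(the explicit Prop. 10.8 bound with `ν ≤ (2/3)a_S`): then `max(1, h(E)) ≤ a_S²` (`a_S ≥ 1728`, `κ ≤ 16.52`).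
The step "`2 log max(1, h(E)) + 36 + 4κ ≤ …`" of the kernel proofs of Prop. 10.1 / Thm. 7.2.
[cite: VonkanelMatschke2023, §10.3 (proofs of Prop. 10.1 and Thm. 7.2: the term 2 log max(1, h(E)))] -/
theorem two_log_max_le_of_two_mul_le {h M : ℝ} (hM : 1728 ≤ M)
    (h2h : 2 * h ≤ vkmKappa + (1 / 9 * M * Real.log M + 1 / 24 * M * Real.log (Real.log (Real.log M)) +
      2 / 27 * M)) :
    2 * Real.log (max 1 h) ≤ 4 * Real.log M := by
  have hκ := vkmKappa_le
  have hl2 := Real.log_two_gt_d9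
  have hM0 : 0 < M := by linarith
  have hlogMle : Real.log M ≤ M - 1 := Real.log_le_sub_one_of_pos hM0
  have h16 : Real.log 16 = 4 * Real.log 2 := by
    rw [show (16 : ℝ) = 2 ^ 4 by norm_num, Real.log_pow]; push_cast; ring
  have hlogM1 : 1 < Real.log M := by
    have := Real.log_le_log (by norm_num) (show (16 : ℝ) ≤ M by linarith)
    linarith
  have hl3le : Real.log (Real.log (Real.log M)) ≤ M := by
    have h' : Real.log (Real.log M) ≤ Real.log M - 1 := Real.log_le_sub_one_of_pos (by linarith)
    have h'' : Real.log (Real.log (Real.log M)) ≤ Real.log (Real.log M) - 1 :=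
      Real.log_le_sub_one_of_pos (Real.log_pos hlogM1)
    linarith
  have h5 : M * Real.log M ≤ M * M := mul_le_mul_of_nonneg_left (by linarith) hM0.le
  have h6 : M * Real.log (Real.log (Real.log M)) ≤ M * M := mul_le_mul_of_nonneg_left hl3le hM0.le
  have hMM : (1728 : ℝ) * M ≤ M * M := mul_le_mul_of_nonneg_right hM hM0.le
  have hmax : max 1 h ≤ M ^ 2 := by rw [max_le_iff]; constructor <;> nlinarith
  have := Real.log_le_log (lt_of_lt_of_le one_pos (le_max_left 1 h)) hmax
  rw [Real.log_pow, Nat.cast_ofNat] at this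
  linarith

/-! ### Theorem 7.2 (i) from the roots -/

/-- **vKM Theorem 7.2 (i) ⟸ {modularity, Lemma 10.3, Lemma 10.4, Prop. 10.8 (i)}** (PROVED: the printed proof of
§10.3 with Prop. 10.8 (ii), `Ω_opt ≤ Ω_sim`, (eq:szpiro), Prop. 10.1 and the Definition-7.1 reduction all
theorems of the tree). The named fact `theorem_7_2_i` is no longer an independent root; with it Theorem G and
Corollary H (`theoremG_of_theorem_7_2_i`, `corollaryH_of_theorem_7_2_i`).
[cite: VonkanelMatschke2023, Thm. 7.2 (i) (arXiv §7, thm:m) with §10.3 (Proof of Theorem (thm:m))] -/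
theorem theorem_7_2_i_of_roots (hmod : nonempty_modularParametrizationData)
    (h103 : vonKanelMatschke_lemma_10_3) (h104 : vonKanelMatschke_lemma_10_4)
    (hi : vonKanelMatschke_prop_10_8_i) : theorem_7_2_i := by
  intro μ hμ S hS a ha haS hap x y hx hy hxy
  obtain ⟨x₀, y₀, hx₀, hy₀, h₀, hap₀⟩ := hap
  obtain ⟨hM, h4, h9⟩ := mordellLevel_dvd_facts hS a
  have hκ := vkmKappa_le
  have hl2 := Real.log_two_lt_d9
  have hl2' := Real.log_two_gt_d9
  have h1728 := log_1728_le
  have hsz := log_minimalDiscriminant_le_of_prop_10_8_i hmod hi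
  -- the curve of Lemma 10.4 attached to the reduction of a solution, and what (eq:szpiro) says about it
  have curve : ∀ {x₁ y₁ : ℚ}, IsSInteger S x₁ → IsSInteger S y₁ → y₁ ^ 2 = x₁ ^ 3 + a →
      ∃ (x' y' : ℤ) (h : ℝ),
        logHeight₁ a ≤ 6 * logHeight₁ (uRatio x₁ y₁) + Real.log 1728 +
          (2 / 3 * (mordellLevel S a : ℝ) * Real.log (mordellLevel S a) +
            1 / 4 * (mordellLevel S a : ℝ) * Real.log (Real.log (Real.log (mordellLevel S a))) +
            4 / 9 * (mordellLevel S a : ℝ) + 115.1) ∧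
        logHeight₁ x₁ ≤ 2 * logHeight₁ (uRatio x₁ y₁) + logHeight₁ (x' : ℚ) ∧
        logHeight₁ y₁ ≤ 3 * logHeight₁ (uRatio x₁ y₁) + logHeight₁ (y' : ℚ) ∧
        max (logHeight₁ (x' : ℚ)) (2 / 3 * logHeight₁ (y' : ℚ)) ≤ 4 * h + 2 * Real.log (max 1 h) + 28 ∧
        2 * h ≤ vkmKappa + (1 / 9 * (mordellLevel S a : ℝ) * Real.log (mordellLevel S a) +
          1 / 24 * (mordellLevel S a : ℝ) * Real.log (Real.log (Real.log (mordellLevel S a))) +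
          2 / 27 * (mordellLevel S a : ℝ)) ∧
        2 * Real.log (max 1 h) ≤ 4 * Real.log (mordellLevel S a) := by
    intro x₁ y₁ hx₁ hy₁ h₁
    obtain ⟨x', y', a', ha'0, hprim, hsol, hlev, hha, hhx, hhy⟩ := exists_primitive_reduction ha hx₁ hy₁ h₁
    obtain ⟨W, hW, hWmin, u, -, -, -, hNdvd, ⟨m, hm, n, hn, hΔ⟩, -, hbound⟩ :=
      h104 S hS a' ha'0 x' y' hprim hsol
    haveI := hW
    haveI := hWmin
    haveI : NeZero (W.conductorNorm ℤ) := ⟨(conductorNorm_pos_holds W).ne'⟩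
    obtain ⟨D⟩ := hmod W
    have hN11 : 11 ≤ W.conductorNorm ℤ := eleven_le_conductorNorm_of_modularity hmod W
    have h2h := two_mul_height_le_of_prop_10_8_i hi W (W.conductorNorm ℤ) rfl hN11 D
    have hL := hbound D.L D.isNeronLattice
    have hszW := hsz W
    have hNM : W.conductorNorm ℤ ∣ mordellLevel S a := by
      have h' : W.conductorNorm ℤ ∣ mordellLevel S (a' : ℚ) := by exact_mod_cast hNdvd
      exact h'.trans hlev
    have hloga' := log_abs_le_of_delta_eq ha'0 hm hn hΔ
    obtain ⟨hν, hν1, hν3, hl3M, hlogM, hNM'⟩ := nu_terms_le hN11 hNM hM h4 h9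
    have hν0 := condNu_nonneg (W.conductorNorm ℤ)
    have h2h' : 2 * neronLatticeHeight D.L ≤ vkmKappa + (1 / 9 * (mordellLevel S a : ℝ) *
        Real.log (mordellLevel S a) + 1 / 24 * (mordellLevel S a : ℝ) *
        Real.log (Real.log (Real.log (mordellLevel S a))) + 2 / 27 * (mordellLevel S a : ℝ)) := by linarith
    have hM' : (1728 : ℝ) ≤ (mordellLevel S a : ℝ) := by exact_mod_cast hM
    exact ⟨x', y', neronLatticeHeight D.L, by linarith, hhx, hhy, hL, h2h', two_log_max_le_of_two_mul_le hM' h2h'⟩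
  have hM' : (1728 : ℝ) ≤ (mordellLevel S a : ℝ) := by exact_mod_cast hM
  set M : ℝ := (mordellLevel S a : ℝ) with hMdef
  have hlogM : Real.log M ≤ 11 * Real.log 2 + (M / 1728 - 1) := (nu_terms_le (N := mordellLevel S a)
    (by omega) dvd_rfl hM h4 h9).2.2.2.2.1
  -- the `h(a)` bound from the almost primitive solution `(x₀, y₀)`
  obtain ⟨-, -, -, hha, -⟩ := curve hx₀ hy₀ h₀
  have hu₀ : logHeight₁ (uRatio x₀ y₀) ≤ μ (mordellLevel S a) := hap₀
  have hμ0 := hμ (mordellLevel S a)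
  constructor
  · -- first display, through Prop. 10.1
    have hΩ := mordell_height_le_of_lemma_10_3_of_prop_10_8_i hmod h103 hi S hS a ha haS x y hx hy hxy
    rw [omegaSim] at hΩ
    linarith
  · -- second display, for an almost primitive `(x, y)`
    intro hapxy
    obtain ⟨x', y', h, -, hhx, hhy, hL, h2h, hlogmax⟩ := curve hx hy hxy
    have hu : logHeight₁ (uRatio x y) ≤ μ (mordellLevel S a) := hapxy
    have hx' : logHeight₁ (x' : ℚ) ≤ 4 * h + 2 * Real.log (max 1 h) + 28 := (le_max_left _ _).trans hL
    have hy' : 2 / 3 * logHeight₁ (y' : ℚ) ≤ 4 * h + 2 * Real.log (max 1 h) + 28 :=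
      (le_max_right _ _).trans hL
    exact max_le (by linarith) (by linarith)

end VonKanelMatschke

end Literature.NumberTheory.DiophantineGeometry

end
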